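import Literature.AlgebraicGeometry.Motives.AbsolutelyTateClasses
import Literature.AlgebraicGeometry.Motives.CrystallineTateClasses

/-!
# Sketch — crux `HodgeBeyondAnchors` (stmt-HodgeConjecture-14054), ideator 2, round 1

First lemmas of the two crux idea cards, stated over EXISTING tree declarations
(`CrystallineFrobeniusDatum`, `DeRhamRealization`, `CrystallineRealization`):

* card `fixed-part-frobenius-frame`:
  - `range_pullback_phi_stable` (PROVED): the image of `H^i_dR(Y) → H^i_dR(X)` under a morphism of
    smooth projective varieties with good reduction at `v` is `φ_v`-stable — applied to the fibre
    inclusion `X_s ⟶ 𝒳̄` of a smooth compactification of the total space of a family, this is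
    Frobenius-stability of the FIXED PART for free (Deligne's global invariant cycles + Berthelot–Ogus
    functoriality);
  - `RankOneNewFixedPartTate` (named `Prop`, the card's first conjectural-but-provable lemma): if the
    fixed part is pure of type `(r,r)` and is spanned by algebraic classes and ONE more class `α`,
    then `α` is a Tate class at `v` up to a root of unity (`φ_v^N (1 ⊗ α) = q^{rN} (1 ⊗ α)`);
  - `pivot_transfer` (PROVED): if two fibre inclusions `f : X ⟶ Y`, `f' : X' ⟶ Y` kill the same
    classes of `Y` (both fibres of one connected family) and `φ_v^N = c` on `H^i(X')` (a PIVOT fibre: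
    supersingular-torsion / absolute-Hodge-known), then `φ_v^N = c` on the fixed part at `X`.
* card `relative-seeds-horizontal-chern`:
  - `bo_chCris_pullback_mem_range` (PROVED): the crystalline Chern character of the restriction to a
    fibre `X_x ⊂ 𝒴_k` of a vector bundle living on the special fibre of the (compactified) TOTAL SPACE
    `𝒴/W` lands, under Berthelot–Ogus, in the de Rham image `H_dR(𝒴_K) → H_dR(X_K)` — total-space /
    relative bundles are seeds whose Chern character sits in the fixed part automatically.
-/

set_option linter.dupNamespace false

noncomputable section

open CategoryTheory AlgebraicGeometry IsDedekindDomain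
open scoped TensorProduct NumberField Isocrystal

namespace Summit.HodgeConjecture.HodgeConjecture.Cruxes.HodgeBeyondAnchors.IdeatorTwo

open Literature.AlgebraicGeometry.Motives

/-! ## Number-field / linear-Frobenius form (`CrystallineFrobeniusDatum`) -/

section NumberField

variable {k : Type} [Field k] [NumberField k] {D : DeRhamRealization k}
  {v : HeightOneSpectrum (𝓞 k)} {L : Type} [Field L] [Algebra k L]
  (Φ : CrystallineFrobeniusDatum D v L)

/-- **Fixed-part Frobenius stability (card `fixed-part-frobenius-frame`, step 1; PROVED).**
For a `k`-morphism `f : X ⟶ Y` of smooth projective varieties both with good reduction at `v`, the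
`L`-span of the image of `f^* : H^i_dR(Y/k) → H^i_dR(X/k)` is stable under the linear crystalline
Frobenius `φ_v` of `X`. With `Y = 𝒳̄` a smooth projective compactification of the total space of a
smooth projective family and `X = X_s` a fibre, the image is Deligne's FIXED PART, which is thus
`φ_v`-stable by pure functoriality (Berthelot–Ogus 1983, Thm. 4.2). -/
theorem range_pullback_phi_stable {n m : ℕ} {X Y : SchemeOver k} (hX : IsSmoothProjective n X)
    (hXv : HasGoodReductionAt X n v) (hY : IsSmoothProjective m Y) (hYv : HasGoodReductionAt Y m v)
    (f : X ⟶ Y) (i : ℕ) {x : L ⊗[k] D.obj X i}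
    (hx : x ∈ LinearMap.range ((D.pullback f i).baseChange L)) :
    Φ.phi X i x ∈ LinearMap.range ((D.pullback f i).baseChange L) := by
  obtain ⟨y, rfl⟩ := hx
  exact ⟨Φ.phi Y i y, (Φ.phi_pullback hX hXv hY hYv f i y).symm⟩

/-- Iterated naturality: `φ_X^M ∘ f^* = f^* ∘ φ_Y^M`. -/
theorem phi_pow_pullback {n m : ℕ} {X Y : SchemeOver k} (hX : IsSmoothProjective n X)
    (hXv : HasGoodReductionAt X n v) (hY : IsSmoothProjective m Y) (hYv : HasGoodReductionAt Y m v)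
    (f : X ⟶ Y) (i : ℕ) (M : ℕ) (y : L ⊗[k] D.obj Y i) :
    ((Φ.phi X i) ^ M) ((D.pullback f i).baseChange L y) =
      (D.pullback f i).baseChange L (((Φ.phi Y i) ^ M) y) := by
  induction M generalizing y with
  | zero => simp
  | succ M ih =>
      rw [pow_succ, Module.End.mul_apply, Φ.phi_pullback hX hXv hY hYv f i y, ih, pow_succ,
        Module.End.mul_apply]

/-- **Pivot transfer (card `fixed-part-frobenius-frame`, genuineness input (G3); PROVED).**
Let `f : X ⟶ Y` and `f' : X' ⟶ Y` be two `k`-morphisms into the same smooth projective `Y` (two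
fibres of one connected family inside the compactified total space) whose pull-backs kill the
same classes (`ker f^* = ker f'^*`: a horizontal section vanishing on one fibre vanishes on all).
If `φ_v^N = c · id` on all of `H^i_dR(X') ⊗ L` — `X'` is a PIVOT: its reduction at `v` has, in
degree `i`, semisimple Frobenius with all eigenvalues `q^{i/2}ζ`, `ζ^N = 1` (e.g. a Fermat or
supersingular-abelian fibre) — then `φ_v^N = c · id` on the fixed part at `X`: the Frobenius of the
whole component's fixed part is pinned by the zeta function of ONE special fibre. -/
theorem pivot_transfer {n n' m : ℕ} {X X' Y : SchemeOver k} (hX : IsSmoothProjective n X)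
    (hXv : HasGoodReductionAt X n v) (hX' : IsSmoothProjective n' X')
    (hX'v : HasGoodReductionAt X' n' v) (hY : IsSmoothProjective m Y)
    (hYv : HasGoodReductionAt Y m v) (f : X ⟶ Y) (f' : X' ⟶ Y) (i : ℕ)
    (hker : LinearMap.ker ((D.pullback f i).baseChange L) =
      LinearMap.ker ((D.pullback f' i).baseChange L))
    (c : L) (N : ℕ) (hpiv : ∀ y : L ⊗[k] D.obj X' i, ((Φ.phi X' i) ^ N) y = c • y)
    {x : L ⊗[k] D.obj X i} (hx : x ∈ LinearMap.range ((D.pullback f i).baseChange L)) :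
    ((Φ.phi X i) ^ N) x = c • x := by
  obtain ⟨y, rfl⟩ := hx
  -- the class `w = φ_Y^N y - c y` dies on the pivot fibre, hence on every fibre
  set w : L ⊗[k] D.obj Y i := ((Φ.phi Y i) ^ N) y - c • y with hw
  have hw' : (D.pullback f' i).baseChange L w = 0 := by
    rw [hw, map_sub, LinearMap.map_smul, ← phi_pow_pullback Φ hX' hX'v hY hYv f' i N y, hpiv,
      sub_self]
  have hwf : (D.pullback f i).baseChange L w = 0 := by
    have : w ∈ LinearMap.ker ((D.pullback f' i).baseChange L) := hw'
    rw [← hker] at this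
    exact this
  rw [hw, map_sub, LinearMap.map_smul, sub_eq_zero] at hwf
  rw [phi_pow_pullback Φ hX hXv hY hYv f i N y, hwf]

/-- **Rank-one genuineness (card `fixed-part-frobenius-frame`, first conjectural lemma; a
THEOREM on paper: weak admissibility + Hodge–Riemann pin the slope, global class field theory +
Sen make the Galois character on the line finite).** For a fibre inclusion `f : X ⟶ Y` into the
compactified total space (both smooth projective with good reduction at `v`) and a class
`α ∈ H^{2r}_dR(X/k)` in the fixed part `I = im f^*`, assume (FP) `I ⊆ F^r`, (purity)
`I ∩ F^{r+1} = 0`, and (rank one) `I ⊆ Alg^r(X) + k·α` — the fixed part is spanned by algebraic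
classes and `α` (Voisin's condition "no constant sub-VHS but `ℚα`", modulo algebraic classes).
Then `α` is a Tate class at `v` up to a root of unity: `φ_v^N (1 ⊗ α) = q_v^{rN} (1 ⊗ α)` for some
`N ≥ 1`. This replaces the route's informal P4 `OgusCrystallineTate` on rank-one components. -/
def RankOneNewFixedPartTate : Prop :=
  ∀ ⦃n m : ℕ⦄ ⦃X Y : SchemeOver k⦄, IsSmoothProjective n X → HasGoodReductionAt X n v →
    IsSmoothProjective m Y → HasGoodReductionAt Y m v → ∀ (f : X ⟶ Y) (r : ℕ)
      (α : D.obj X (2 * r)),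
      α ∈ LinearMap.range (D.pullback f (2 * r)) →
      LinearMap.range (D.pullback f (2 * r)) ≤ D.fil (X := X) (2 * r) (r : ℤ) →
      LinearMap.range (D.pullback f (2 * r)) ⊓ D.fil (X := X) (2 * r) ((r : ℤ) + 1) = ⊥ →
      LinearMap.range (D.pullback f (2 * r)) ≤ D.algebraicClasses X r ⊔ Submodule.span k {α} →
        ∃ N : ℕ, 0 < N ∧
          ((Φ.phi X (2 * r)) ^ N) ((1 : L) ⊗ₜ[k] α) =
            (((v.residueCard : L) ^ r) ^ N) • ((1 : L) ⊗ₜ[k] α)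

/-- Sanity: the algebraic part of the hypothesis is already Tate on the nose (`N = 1`), by the
datum's `phi_cycleClass` — so `RankOneNewFixedPartTate` is exactly about the one new line. -/
theorem phi_pow_of_mem_algebraicClasses {n : ℕ} {X : SchemeOver k} (hX : IsSmoothProjective n X)
    (hXv : HasGoodReductionAt X n v) (r N : ℕ) {x : D.obj X (2 * r)}
    (hx : x ∈ D.algebraicClasses X r) :
    ((Φ.phi X (2 * r)) ^ N) ((1 : L) ⊗ₜ[k] x) =
      (((v.residueCard : L) ^ r) ^ N) • ((1 : L) ⊗ₜ[k] x) := by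
  induction N with
  | zero => simp
  | succ N ih =>
      rw [pow_succ', Module.End.mul_apply, ih, LinearMap.map_smul,
        Φ.phi_tmul_of_mem_algebraicClasses hX hXv r hx, smul_smul, ← pow_succ]

end NumberField

/-! ## `W(k)`-model / semilinear form (`CrystallineRealization`) -/

section Models

universe u

variable {p : ℕ} [Fact p.Prime] {k : Type u} [Field k] [CharP k p] [PerfectRing k p]
  (C : CrystallineRealization p k)

/-- **Relative seeds carry fixed-part Chern characters (card `relative-seeds-horizontal-chern`,
first lemma; PROVED).** Let `h : 𝒳 ⟶ 𝒴` be a morphism of `W(k)`-schemes (intended: the inclusion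
of the fibre `𝒳 = 𝒳_t` over a `W`-point `t` of the Hodge locus into the compactified total space
`𝒴`) and `E` a vector bundle on the special fibre `𝒴_k` of the TOTAL space. Then the Berthelot–Ogus
image of `ch_r^{cris}(E|_{X_k})` lies in the de Rham image `H^{2r}_dR(𝒴_K) → H^{2r}_dR(X_K)`, i.e.
in the fixed part `⊗ K` — so such an `E|_{X_k}` satisfies the Bloch–Esnault–Kerz Hodge condition at
`t` as soon as the fixed part is pure `(r,r)` (it then lies in `F^r H_dR(X_K)`), with no
computation on the special fibre. -/
theorem bo_chCris_pullback_mem_range {𝒳 𝒴 : SchemeOver (WittVector p k)} (h : 𝒳 ⟶ 𝒴)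
    (E : (WittScheme.specialFibre 𝒴).left.Modules) (hE : IsVectorBundle E) (r : ℕ) :
    C.bo 𝒳 (2 * r)
        (C.chCris (WittScheme.specialFibre 𝒳)
          ((Scheme.Modules.pullback
            ((baseChangeHom (WittVector.constantCoeff : WittVector p k →+* k)).map h).left).obj E) r)
      ∈ LinearMap.range (C.dR.pullback ((baseChange (WittVector p k) K(p, k)).map h) (2 * r)) := by
  refine ⟨C.bo 𝒴 (2 * r) (C.chCris (WittScheme.specialFibre 𝒴) E r), ?_⟩
  rw [← C.bo_naturality h (2 * r)]
  congr 1
  exact C.pullback_chCris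
    ((baseChangeHom (WittVector.constantCoeff : WittVector p k →+* k)).map h) E hE r

/-- The fixed part `⊗ K` at a `W`-model, as a `K`-subspace of `H^{2r}(X_k)`: the `bo`-preimage of
the de Rham image of the total space. It is `φ`-stable (semilinear Frobenius) by
`frobK_pullback` — the model-wise twin of `range_pullback_phi_stable`. -/
theorem frobK_mem_fixedPart {𝒳 𝒴 : SchemeOver (WittVector p k)} (h : 𝒳 ⟶ 𝒴) (i : ℕ)
    {x : C.obj (WittScheme.specialFibre 𝒳) i}
    (hx : x ∈ LinearMap.range
      (C.pullback ((baseChangeHom (WittVector.constantCoeff : WittVector p k →+* k)).map h) i)) :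
    C.frobK (WittScheme.specialFibre 𝒳) i x ∈ LinearMap.range
      (C.pullback ((baseChangeHom (WittVector.constantCoeff : WittVector p k →+* k)).map h) i) := by
  obtain ⟨y, rfl⟩ := hx
  exact ⟨C.frobK _ i y, (C.frobK_pullback _ i y).symm⟩

/-- **Frame statement (card `fixed-part-frobenius-frame`, model-wise conclusion consumed by the
route's engine; named `Prop`).** For `k` algebraically closed and a morphism of smooth proper
`W(k)`-models `h : 𝒳 ⟶ 𝒴` (fibre over a `W`-point of the Hodge locus ↪ compactified total space)
whose de Rham image `I_K ⊆ H^{2r}_dR(X_K)` is pure: `I_K ⊆ F^r` and `I_K ∩ F^{r+1} = 0`, the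
crystalline fixed part `bo⁻¹(I_K) ⊆ H^{2r}(X_k)` is SPANNED OVER `K` BY TATE CLASSES
(`φ x = p^r x`): weak admissibility + Hodge–Riemann make the `φ`-stable fixed part isoclinic of
slope `r`, and Dieudonné–Manin/Lang trivialise it over `W(k̄)`. Consequence: every class of `I_K`
(in particular the target Hodge class) is a `K`-combination of crystalline Tate classes that are
Hodge on `X_K` — the input the seed step needs, with no appeal to Ogus's conjecture. -/
def FixedPartTateFrame [IsAlgClosed k] : Prop :=
  ∀ ⦃n m : ℕ⦄ ⦃𝒳 𝒴 : SchemeOver (WittVector p k)⦄ (h : 𝒳 ⟶ 𝒴),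
    WittScheme.IsSmoothProperModel n 𝒳 → WittScheme.IsSmoothProperModel m 𝒴 → ∀ r : ℕ,
      LinearMap.range (C.dR.pullback ((baseChange (WittVector p k) K(p, k)).map h) (2 * r)) ≤
          C.dR.fil (X := WittScheme.genericFibre 𝒳) (2 * r) (r : ℤ) →
      LinearMap.range (C.dR.pullback ((baseChange (WittVector p k) K(p, k)).map h) (2 * r)) ⊓
          C.dR.fil (X := WittScheme.genericFibre 𝒳) (2 * r) ((r : ℤ) + 1) = ⊥ →
      LinearMap.range
          (C.pullback ((baseChangeHom (WittVector.constantCoeff : WittVector p k →+* k)).map h)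
            (2 * r)) ≤
        Submodule.span K(p, k)
          (SetLike.coe (C.tateClasses
            ((baseChangeHom (WittVector.constantCoeff : WittVector p k →+* k)).obj 𝒳) r))

end Models

end Summit.HodgeConjecture.HodgeConjecture.Cruxes.HodgeBeyondAnchors.IdeatorTwo

end
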